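import Literature.Analysis.FluidPDE.PeriodicLerayTransport
import Literature.Analysis.FluidPDE.NSSuitableESSProofs
import Literature.Analysis.FluidPDE.WeakSpatialGradientSum
import Literature.Analysis.FluidPDE.ClassicalSuitable
import HarnessLib

/-!
# [BT1] §4 ¶1–3, the transport of suitable periodic weak solutions, II: the periodised weak
  gradient and its dissipation on arbitrary time windows

Analysis/FluidPDE proof file (theorems only), second part of the
discharge of the named fact `Literature.Analysis.FluidPDE.bradshawTsai2017_ansatz_transport`
(`PeriodicLeraySystem.lean`; Bradshaw–Tsai, Ann. Henri Poincaré 18 (2017) = arXiv:1510.07504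
[BT1], §4, proof of Thm 1.2, ¶1–3), continuing `PeriodicLerayTransport.lean`.

The suitable periodic weak solution `(u, p)` of [BT1] Def. 2.2–2.3
(`BradshawTsai2017.IsSuitablePeriodicWeakSolution T U₀ u p`) carries one weak spatial gradient
`G = ∇u` on all of `ℝ × ℝ³` whose dissipation `∫∫ |G − DU₀|²` is only recorded on the period
window `(0, T) × ℝ³` (the class `u − U₀ ∈ L²(0,T;H¹)`), whereas the physical time window
`1 ≤ t ≤ λ²` of the ansatz is the window `(σ(1), σ(1) + T)`, `σ(1) = log √2`, of the similarity
time, and the local classes on the slab `t > 0` see every window. Since `u` is `T`-periodic and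
weak gradients are unique a.e. (`HasWeakSpatialGradientOn.ae_eq`), `G` is a.e. `T`-periodic in
`s`; this file replaces it by a **literally periodic representative** and draws the consequences:

* `HasWeakSpatialGradientOn.congr_grad_ae`: a weak spatial gradient may be modified on a null
  set; `HasWeakSpatialGradientOn.comp_add_time`: time translates (the case `β = γ = 1` of the
  accepted affine covariance `HasWeakSpatialGradientOn.stRescale`);
  `HasWeakSpatialGradientOn.ae_eq_comp_add_time`: for a `T`-periodic field every weak spatial
  gradient on `ℝ × E` satisfies `G(s + T, ·) = G(s, ·)` a.e., and simultaneously for all integer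
  multiples of `T` (`ae_forall_comp_add_int_mul`);
* the periodisation in time `(s, y) ↦ G(T·fract(s/T), y)`: it is `T`-periodic
  (`periodize_add`), agrees with `G` a.e. (`HasWeakSpatialGradientOn.periodize_ae_eq`) and is
  again a weak spatial gradient of `u` (`HasWeakSpatialGradientOn.periodize`);
* lower integrals of time-periodic space–time densities over `(a, a + nT] × E` and over
  arbitrary bounded windows `(a, b) × E` are controlled by the integral over one period
  (`setLIntegral_Ioc_prod_le_of_periodic`, `setLIntegral_Ioo_prod_lt_top_of_periodic`);
* for the periodic Leray system ([BT1] Def. 2.2: "`u − U₀ ∈ L²(0,T;H¹(ℝ³))`", with `U₀`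
  `T`-periodic and `C¹`, Assumption 2.1): the periodised gradient `G̃` has
  `∫∫_{(a,b)×ℝ³} |G̃ − DU₀|² < ∞` for **every** bounded window
  (`BradshawTsai2017.setLIntegral_window_sub_lt_top_of_periodic`), `H − DU₀` is a weak spatial
  gradient of `u − U₀` on `ℝ × ℝ³` for every weak spatial gradient `H` of `u`
  (`hasWeakSpatialGradientOn_sub_profile`), `|G̃|²` is integrable on compact sets
  (`setLIntegral_isCompact_lt_top_of_window`), and everything is bundled as an existence
  statement: **a periodic field with a weak spatial gradient of finite dissipation (relative to
  a periodic `C¹` profile) over one period has a `T`-periodic weak spatial gradient, a.e. equal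
  to the given one, of finite dissipation over every bounded window**
  (`exists_periodic_weakGradient`).

## References

* Z. Bradshaw, T.-P. Tsai, Ann. Henri Poincaré 18 (2017) = arXiv:1510.07504, Def. 2.2–2.3 and
  §4 (proof of Thm 1.2) [BradshawTsai2017AHP].
* L. C. Evans, *Partial differential equations*, §5.2.1 (uniqueness of weak derivatives)
  [Evans2010].
-/

noncomputable section

open MeasureTheory TopologicalSpace Set Function Filter Topology Module Metric
open scoped InnerProductSpace RealInnerProductSpace ENNReal NNReal

namespace Literature.Analysis.FluidPDE

/-! ### Weak spatial gradients: modification on null sets, time translation, a.e. periodicity -/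

section General

variable {E : Type*} [NormedAddCommGroup E] [InnerProductSpace ℝ E] [FiniteDimensional ℝ E]
  [MeasurableSpace E] [BorelSpace E]

/-- **A weak spatial gradient may be modified on a null set of `Q`** (the defining identity only
sees `G` through integrals against test functions supported in `Q`; Evans, *PDE*, §5.2.1). [folklore] -/
theorem HasWeakSpatialGradientOn.congr_grad_ae {Q : Opens (ℝ × E)} {u : ℝ → E → E}
    {G G' : ℝ → E → E →L[ℝ] E} (h : HasWeakSpatialGradientOn Q u G)
    (hG : ∀ᵐ z ∂(volume.restrict (Q : Set (ℝ × E))), uncurry G' z = uncurry G z) :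
    HasWeakSpatialGradientOn Q u G' := by
  have hae : uncurry G =ᵐ[volume.restrict (Q : Set (ℝ × E))] uncurry G' :=
    hG.mono fun z hz => hz.symm
  refine ⟨h.locallyIntegrableOn, LocallyIntegrableOn.congr hae h.locallyIntegrableOn_grad,
    fun φ hφ v w => ?_⟩
  rw [h.integral_fderiv_mul_inner_eq φ hφ v w]
  congr 1
  refine integral_integral_congr_ae_prod ?_
  filter_upwards [ae_imp_of_ae_restrict hG] with z hz
  by_cases hzQ : z ∈ (Q : Set (ℝ × E))
  · have e : G' z.1 z.2 = G z.1 z.2 := hz hzQ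
    rw [e]
  · rw [hφ.apply_eq_zero hzQ, zero_mul, zero_mul]

/-- **Time translates of weak spatial gradients**: if `G` is a weak spatial gradient of `u` on
`ℝ × E`, then `G(· + T, ·)` is one of `u(· + T, ·)` (the case `β = γ = 1`, `t₀ = T`, `x₀ = 0` of
the affine covariance `HasWeakSpatialGradientOn.stRescale`). [folklore] -/
theorem HasWeakSpatialGradientOn.comp_add_time {u : ℝ → E → E} {G : ℝ → E → E →L[ℝ] E}
    (h : HasWeakSpatialGradientOn (⊤ : Opens (ℝ × E)) u G) (T : ℝ) :
    HasWeakSpatialGradientOn (⊤ : Opens (ℝ × E)) (fun s y => u (s + T) y)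
      (fun s y => G (s + T) y) := by
  have h1 := h.stRescale 1 one_pos one_pos T 0
  have e0 : stPreimage 1 1 T (0 : E) (⊤ : Opens (ℝ × E)) = ⊤ := by
    ext z
    simp only [SetLike.mem_coe, mem_stPreimage, Opens.mem_top]
  have e1 : ((1 : ℝ) • stPull 1 1 T (0 : E) u) = fun s y => u (s + T) y := by
    funext s y
    rw [smul_stPull_apply, one_smul, one_mul, zero_add, one_smul, add_comm T s]
  have e2 : (((1 : ℝ) * 1) • stPull 1 1 T (0 : E) G) = fun s y => G (s + T) y := by
    funext s y
    change ((1 : ℝ) * 1) • G (T + 1 * s) (0 + (1 : ℝ) • y) = G (s + T) y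
    rw [mul_one, one_smul, one_mul, zero_add, one_smul, add_comm T s]
  rwa [e0, e1, e2] at h1

/-- **A.e. periodicity of weak spatial gradients of periodic fields**: if `u` is `T`-periodic in
time and `G` is a weak spatial gradient of `u` on `ℝ × E`, then `G(s + T, y) = G(s, y)` for a.e.
`(s, y)` (both are weak spatial gradients of `u`, which are unique a.e.; Evans, *PDE*, §5.2.1). [folklore] -/
theorem HasWeakSpatialGradientOn.ae_eq_comp_add_time {u : ℝ → E → E} {G : ℝ → E → E →L[ℝ] E}
    (h : HasWeakSpatialGradientOn (⊤ : Opens (ℝ × E)) u G) {T : ℝ}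
    (hu : ∀ s y, u (s + T) y = u s y) :
    ∀ᵐ z : ℝ × E, G (z.1 + T) z.2 = G z.1 z.2 := by
  have h1 := h.comp_add_time T
  have e : (fun s y => u (s + T) y) = u := funext fun s => funext fun y => hu s y
  rw [e] at h1
  have h2 := h1.ae_eq h
  rw [Opens.coe_top, Measure.restrict_univ] at h2
  filter_upwards [h2] with z hz
  exact hz

/-- The same simultaneously for all integer multiples of the period: for a.e. `(s, y)`,
`G(s + kT, y) = G(s, y)` for every `k ∈ ℤ`. [folklore] -/
theorem HasWeakSpatialGradientOn.ae_forall_comp_add_int_mul {u : ℝ → E → E}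
    {G : ℝ → E → E →L[ℝ] E} (h : HasWeakSpatialGradientOn (⊤ : Opens (ℝ × E)) u G) {T : ℝ}
    (hu : ∀ s y, u (s + T) y = u s y) :
    ∀ᵐ z : ℝ × E, ∀ k : ℤ, G (z.1 + k * T) z.2 = G z.1 z.2 := by
  have hper : ∀ k : ℤ, ∀ s y, u (s + k * T) y = u s y := by
    intro k s y
    have hp : Function.Periodic (fun s => u s y) T := fun s => hu s y
    exact hp.int_mul k s
  rw [ae_all_iff]
  intro k
  exact h.ae_eq_comp_add_time (hper k)

end General

/-! ### Periodisation in time -/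

section Periodize

variable {X Y : Type*}

/-- `T · fract(s/T) = s − ⌊s/T⌋ T` is `s` shifted by an integer multiple of `T`. [folklore] -/
theorem fract_div_mul_eq {T : ℝ} (hT : T ≠ 0) (s : ℝ) :
    Int.fract (s / T) * T = s + ((-⌊s / T⌋ : ℤ) : ℝ) * T := by
  rw [Int.fract, sub_mul, div_mul_cancel₀ s hT]
  push_cast
  ring

/-- **Periodisation in time.** The field `(s, y) ↦ G(T · fract(s/T), y)` — `G` restricted to the
period window `[0, T)` and extended `T`-periodically — is `T`-periodic in `s` (`T ≠ 0`). Used to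
replace an a.e.-periodic weak gradient by a literally periodic representative. [folklore] -/
theorem periodize_add {T : ℝ} (hT : T ≠ 0) (G : ℝ → X → Y) (s : ℝ) (y : X) :
    G (Int.fract ((s + T) / T) * T) y = G (Int.fract (s / T) * T) y := by
  rw [add_div, div_self hT, Int.fract_add_one]

variable {E : Type*} [NormedAddCommGroup E] [InnerProductSpace ℝ E] [FiniteDimensional ℝ E]
  [MeasurableSpace E] [BorelSpace E]

/-- **The periodisation of a weak spatial gradient of a periodic field agrees with it a.e.**
(`G(s + kT, ·) = G(s, ·)` a.e. for all `k ∈ ℤ` at once, and `T·fract(s/T) = s − ⌊s/T⌋T`). [folklore] -/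
theorem HasWeakSpatialGradientOn.periodize_ae_eq {u : ℝ → E → E} {G : ℝ → E → E →L[ℝ] E}
    (h : HasWeakSpatialGradientOn (⊤ : Opens (ℝ × E)) u G) {T : ℝ} (hT : T ≠ 0)
    (hu : ∀ s y, u (s + T) y = u s y) :
    ∀ᵐ z : ℝ × E, G (Int.fract (z.1 / T) * T) z.2 = G z.1 z.2 := by
  filter_upwards [h.ae_forall_comp_add_int_mul hu] with z hz
  rw [fract_div_mul_eq hT]
  exact hz _

/-- **The periodised weak gradient is a weak spatial gradient** of the same periodic field on
`ℝ × E` (modification on a null set). [folklore] -/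
theorem HasWeakSpatialGradientOn.periodize {u : ℝ → E → E} {G : ℝ → E → E →L[ℝ] E}
    (h : HasWeakSpatialGradientOn (⊤ : Opens (ℝ × E)) u G) {T : ℝ} (hT : T ≠ 0)
    (hu : ∀ s y, u (s + T) y = u s y) :
    HasWeakSpatialGradientOn (⊤ : Opens (ℝ × E)) u fun s y => G (Int.fract (s / T) * T) y := by
  refine h.congr_grad_ae ?_
  rw [Opens.coe_top, Measure.restrict_univ]
  filter_upwards [h.periodize_ae_eq hT hu] with z hz
  exact hz

/-! ### Lower integrals of time-periodic densities over long windows -/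

/-- **Lower integrals of a time-periodic space–time density over `n` periods**:
`∫⁻_{(a, a+nT] × E} f ≤ n ∫⁻_{(0,T] × E} f` (in fact equality; `≤` is what is used). [folklore] -/
theorem setLIntegral_Ioc_prod_le_of_periodic {f : ℝ × E → ℝ≥0∞} (hf : AEMeasurable f volume)
    {T : ℝ} (hT : 0 < T) (hper : ∀ s y, f (s + T, y) = f (s, y)) (a : ℝ) (n : ℕ) :
    ∫⁻ z in Ioc a (a + n * T) ×ˢ (univ : Set E), f z ≤
      n * ∫⁻ z in Ioc 0 T ×ˢ (univ : Set E), f z := by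
  induction n with
  | zero => simp
  | succ n ih =>
    have hsub : Ioc a (a + ((n + 1 : ℕ) : ℝ) * T) ×ˢ (univ : Set E) ⊆
        Ioc a (a + n * T) ×ˢ (univ : Set E) ∪ Ioc (a + n * T) (a + n * T + T) ×ˢ (univ : Set E) := by
      rw [← union_prod]
      refine prod_mono ?_ Subset.rfl
      intro s hs
      rcases le_or_gt s (a + n * T) with h | h
      · exact Or.inl ⟨hs.1, h⟩
      · refine Or.inr ⟨h, ?_⟩
        have := hs.2
        push_cast at this
        linarith
    calc ∫⁻ z in Ioc a (a + ((n + 1 : ℕ) : ℝ) * T) ×ˢ (univ : Set E), f z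
        ≤ ∫⁻ z in Ioc a (a + n * T) ×ˢ (univ : Set E) ∪
            Ioc (a + n * T) (a + n * T + T) ×ˢ (univ : Set E), f z := lintegral_mono_set hsub
      _ ≤ (∫⁻ z in Ioc a (a + n * T) ×ˢ (univ : Set E), f z) +
            ∫⁻ z in Ioc (a + n * T) (a + n * T + T) ×ˢ (univ : Set E), f z :=
          lintegral_union_le _ _ _
      _ = (∫⁻ z in Ioc a (a + n * T) ×ˢ (univ : Set E), f z) +
            ∫⁻ z in Ioc 0 T ×ˢ (univ : Set E), f z := by
          rw [setLIntegral_Ioc_prod_eq_of_periodic hf hT hper (a + n * T) 0, zero_add]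
      _ ≤ n * (∫⁻ z in Ioc 0 T ×ˢ (univ : Set E), f z) +
            ∫⁻ z in Ioc 0 T ×ˢ (univ : Set E), f z := add_le_add ih le_rfl
      _ = ((n + 1 : ℕ) : ℝ≥0∞) * ∫⁻ z in Ioc 0 T ×ˢ (univ : Set E), f z := by
          push_cast
          ring

/-- **A time-periodic space–time density integrable over one period window is integrable over
every bounded window**: `∫⁻_{(0,T)×E} f < ∞ ⟹ ∫⁻_{(a,b)×E} f < ∞`. [folklore] -/
theorem setLIntegral_Ioo_prod_lt_top_of_periodic {f : ℝ × E → ℝ≥0∞} (hf : AEMeasurable f volume)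
    {T : ℝ} (hT : 0 < T) (hper : ∀ s y, f (s + T, y) = f (s, y))
    (hfin : ∫⁻ z in Ioo 0 T ×ˢ (univ : Set E), f z < ∞) (a b : ℝ) :
    ∫⁻ z in Ioo a b ×ˢ (univ : Set E), f z < ∞ := by
  obtain ⟨n, hn⟩ := exists_nat_gt ((b - a) / T)
  have hb : b ≤ a + n * T := by
    rw [div_lt_iff₀ hT] at hn
    linarith
  have h1 : (Ioo 0 T ×ˢ (univ : Set E) : Set (ℝ × E)) =ᵐ[volume]
      (Ioc 0 T ×ˢ (univ : Set E) : Set (ℝ × E)) := by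
    rw [Measure.volume_eq_prod]
    exact Measure.set_prod_ae_eq Ioo_ae_eq_Ioc (ae_eq_refl _)
  rw [setLIntegral_congr h1] at hfin
  calc ∫⁻ z in Ioo a b ×ˢ (univ : Set E), f z
      ≤ ∫⁻ z in Ioc a (a + n * T) ×ˢ (univ : Set E), f z :=
        lintegral_mono_set (prod_mono (Ioo_subset_Ioc_self.trans (Ioc_subset_Ioc_right hb))
          Subset.rfl)
    _ ≤ n * ∫⁻ z in Ioc 0 T ×ˢ (univ : Set E), f z :=
        setLIntegral_Ioc_prod_le_of_periodic hf hT hper a n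
    _ < ∞ := ENNReal.mul_lt_top (by simp) hfin

omit [InnerProductSpace ℝ E] [FiniteDimensional ℝ E] [MeasurableSpace E] [BorelSpace E] in
/-- Every compact subset of `ℝ × E` lies in a bounded window `(a, b) × E`. [folklore] -/
theorem exists_Ioo_prod_of_isCompact {K : Set (ℝ × E)} (hK : IsCompact K) :
    ∃ a b : ℝ, K ⊆ Ioo a b ×ˢ (univ : Set E) := by
  obtain ⟨a, b, hab⟩ : ∃ a b : ℝ, Prod.fst '' K ⊆ Icc a b :=
    (hK.image continuous_fst).isBounded.subset_Icc_sInf_sSup |> fun h => ⟨_, _, h⟩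
  refine ⟨a - 1, b + 1, fun z hz => ⟨?_, mem_univ _⟩⟩
  have := hab (mem_image_of_mem Prod.fst hz)
  exact ⟨by linarith [this.1], by linarith [this.2]⟩

end Periodize

/-! ### The periodic Leray system: dissipation of the periodised gradient on every window -/

namespace BradshawTsai2017

variable {T : ℝ} {U₀ u : ℝ → (EuclideanSpace ℝ (Fin 3)) → (EuclideanSpace ℝ (Fin 3))} {G : ℝ → (EuclideanSpace ℝ (Fin 3)) → (EuclideanSpace ℝ (Fin 3)) →L[ℝ] (EuclideanSpace ℝ (Fin 3))}

/-- The slice derivative `(s, y) ↦ D(U₀ s)(y)` of a jointly `C¹` profile is continuous. [folklore] -/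
theorem continuous_fderiv_slice_of_contDiff (hU₀ : ContDiff ℝ 1 (uncurry U₀)) :
    Continuous fun z : ℝ × (EuclideanSpace ℝ (Fin 3)) => fderiv ℝ (U₀ z.1) z.2 := by
  have h := continuousOn_fderiv_slice_of_contDiffOn (w := U₀) (S := (univ : Set ℝ))
    (by rw [univ_prod_univ]; exact hU₀.contDiffOn) uniqueDiffOn_univ
  rw [univ_prod_univ] at h
  exact continuousOn_univ.1 h

/-- The classical slice derivative of a jointly `C¹` profile is a weak spatial gradient of it on
`ℝ × ℝ³` (the tree's `hasWeakSpatialGradientOn_of_contDiffOn`). [folklore] -/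
theorem hasWeakSpatialGradientOn_fderiv_profile (hU₀ : ContDiff ℝ 1 (uncurry U₀)) :
    HasWeakSpatialGradientOn (⊤ : Opens (ℝ × (EuclideanSpace ℝ (Fin 3)))) U₀ fun s y => fderiv ℝ (U₀ s) y :=
  hasWeakSpatialGradientOn_of_contDiffOn (S := (univ : Set ℝ)) isOpen_univ
    (by rw [univ_prod_univ]; exact subset_univ _) (by rw [univ_prod_univ]; exact hU₀.contDiffOn)

/-- The negative of a weak spatial gradient is a weak spatial gradient of the negative field. [folklore] -/
theorem _root_.Literature.Analysis.FluidPDE.HasWeakSpatialGradientOn.neg {E : Type*}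
    [NormedAddCommGroup E] [InnerProductSpace ℝ E] [FiniteDimensional ℝ E] [MeasurableSpace E]
    [BorelSpace E] {Q : Opens (ℝ × E)} {w : ℝ → E → E} {H : ℝ → E → E →L[ℝ] E}
    (h : HasWeakSpatialGradientOn Q w H) :
    HasWeakSpatialGradientOn Q (fun s y => -w s y) (fun s y => -H s y) where
  locallyIntegrableOn := by
    have e : uncurry (fun s y => -w s y) = -uncurry w := rfl
    rw [e]; exact h.locallyIntegrableOn.neg
  locallyIntegrableOn_grad := by
    have e : uncurry (fun s y => -H s y) = -uncurry H := rfl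
    rw [e]; exact h.locallyIntegrableOn_grad.neg
  integral_fderiv_mul_inner_eq φ hφ v a := by
    have h1 := h.integral_fderiv_mul_inner_eq φ hφ v a
    have e1 : (fun t => ∫ x, fderiv ℝ (φ t) x v * ⟪-w t x, a⟫) =
        fun t => -∫ x, fderiv ℝ (φ t) x v * ⟪w t x, a⟫ := by
      funext t
      rw [← integral_neg]
      refine integral_congr_ae (Eventually.of_forall fun x => ?_)
      simp only [inner_neg_left, mul_neg]
    have e2 : (fun t => ∫ x, φ t x * ⟪(-H t x) v, a⟫) =
        fun t => -∫ x, φ t x * ⟪H t x v, a⟫ := by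
      funext t
      rw [← integral_neg]
      refine integral_congr_ae (Eventually.of_forall fun x => ?_)
      show φ t x * ⟪(-H t x) v, a⟫ = -(φ t x * ⟪H t x v, a⟫)
      rw [show (-H t x) v = -(H t x v) from rfl, inner_neg_left, mul_neg]
    rw [e1, e2, integral_neg, integral_neg, h1]

/-- **`G̃ − DU₀` is a weak spatial gradient of `u − U₀` on `ℝ × ℝ³`** for the periodised gradient
`G̃` of `u` and the `C¹` profile `U₀` ([BT1] Def. 2.2: the class `u − U₀ ∈ L²(0,T;H¹)` is a
statement about `∇(u − U₀) = ∇u − ∇U₀`). [cite: BradshawTsai2017AHP, Def. 2.2] -/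
theorem hasWeakSpatialGradientOn_sub_profile {H : ℝ → (EuclideanSpace ℝ (Fin 3)) → (EuclideanSpace ℝ (Fin 3)) →L[ℝ] (EuclideanSpace ℝ (Fin 3))}
    (hH : HasWeakSpatialGradientOn (⊤ : Opens (ℝ × (EuclideanSpace ℝ (Fin 3)))) u H) (hU₀ : ContDiff ℝ 1 (uncurry U₀)) :
    HasWeakSpatialGradientOn (⊤ : Opens (ℝ × (EuclideanSpace ℝ (Fin 3)))) (fun s y => u s y - U₀ s y)
      fun s y => H s y - fderiv ℝ (U₀ s) y := by
  have h := hH.add (hasWeakSpatialGradientOn_fderiv_profile hU₀).neg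
  simp only [← sub_eq_add_neg] at h
  exact h

/-- The dissipation density of the periodised gradient relative to the profile,
`|G̃ − DU₀|²`, is a.e.-measurable on `ℝ × ℝ³`. [folklore] -/
theorem aemeasurable_frobeniusNormSq_sub_profile {H : ℝ → (EuclideanSpace ℝ (Fin 3)) → (EuclideanSpace ℝ (Fin 3)) →L[ℝ] (EuclideanSpace ℝ (Fin 3))}
    (hH : HasWeakSpatialGradientOn (⊤ : Opens (ℝ × (EuclideanSpace ℝ (Fin 3)))) u H) (hU₀ : ContDiff ℝ 1 (uncurry U₀)) :
    AEMeasurable (fun z : ℝ × (EuclideanSpace ℝ (Fin 3)) =>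
      ENNReal.ofReal (frobeniusNormSq (H z.1 z.2 - fderiv ℝ (U₀ z.1) z.2))) volume := by
  have h1 : AEStronglyMeasurable (uncurry fun s y => H s y - fderiv ℝ (U₀ s) y) volume := by
    have := (hasWeakSpatialGradientOn_sub_profile hH hU₀).locallyIntegrableOn_grad
    rw [Opens.coe_top, locallyIntegrableOn_univ] at this
    exact this.aestronglyMeasurable
  have h2 : AEStronglyMeasurable (fun z : ℝ × (EuclideanSpace ℝ (Fin 3)) =>
      frobeniusNormSq (H z.1 z.2 - fderiv ℝ (U₀ z.1) z.2)) volume :=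
    LerayHopfProofs.continuous_frobeniusNormSq.comp_aestronglyMeasurable h1
  exact ENNReal.measurable_ofReal.comp_aemeasurable h2.aemeasurable

/-- **A periodic representative dissipates finitely on every bounded window.** Let `u` be
`T`-periodic (`T > 0`) with weak spatial gradient `G` on `ℝ × ℝ³`, `U₀` a `T`-periodic `C¹`
profile, and `∫∫_{(0,T)×ℝ³} |G − DU₀|² < ∞` ([BT1] Def. 2.2: `u − U₀ ∈ L²(0,T;H¹(ℝ³))`). If `G'` is
a `T`-periodic weak spatial gradient of `u` agreeing with `G` a.e. (e.g. the periodisation of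
`G`), then `∫∫_{(a,b)×ℝ³} |G' − DU₀|² < ∞` for all `a, b` (the density `|G' − DU₀|²` is
`T`-periodic and agrees a.e. with `|G − DU₀|²`). [cite: BradshawTsai2017AHP, Def. 2.2 and §4 (proof of Thm 1.2)] -/
theorem setLIntegral_window_sub_lt_top_of_periodic {G' : ℝ → (EuclideanSpace ℝ (Fin 3)) → (EuclideanSpace ℝ (Fin 3)) →L[ℝ] (EuclideanSpace ℝ (Fin 3))}
    (hG' : HasWeakSpatialGradientOn (⊤ : Opens (ℝ × (EuclideanSpace ℝ (Fin 3)))) u G') (hT : 0 < T)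
    (hG'T : ∀ s y, G' (s + T) y = G' s y) (hae : ∀ᵐ z : ℝ × (EuclideanSpace ℝ (Fin 3)), G' z.1 z.2 = G z.1 z.2)
    (hU₀ : ContDiff ℝ 1 (uncurry U₀)) (hU₀T : ∀ s y, U₀ (s + T) y = U₀ s y)
    (hfin : ∫⁻ z in Ioo 0 T ×ˢ (univ : Set (EuclideanSpace ℝ (Fin 3))),
      ENNReal.ofReal (frobeniusNormSq (G z.1 z.2 - fderiv ℝ (U₀ z.1) z.2)) < ∞) (a b : ℝ) :
    ∫⁻ z in Ioo a b ×ˢ (univ : Set (EuclideanSpace ℝ (Fin 3))),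
      ENNReal.ofReal (frobeniusNormSq (G' z.1 z.2 - fderiv ℝ (U₀ z.1) z.2)) < ∞ := by
  have hFm := aemeasurable_frobeniusNormSq_sub_profile hG' hU₀
  have hper : ∀ s y, (fun z : ℝ × (EuclideanSpace ℝ (Fin 3)) =>
      ENNReal.ofReal (frobeniusNormSq (G' z.1 z.2 - fderiv ℝ (U₀ z.1) z.2))) (s + T, y) =
      (fun z : ℝ × (EuclideanSpace ℝ (Fin 3)) =>
        ENNReal.ofReal (frobeniusNormSq (G' z.1 z.2 - fderiv ℝ (U₀ z.1) z.2))) (s, y) := by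
    intro s y
    have e : U₀ (s + T) = U₀ s := funext fun y => hU₀T s y
    show ENNReal.ofReal (frobeniusNormSq (G' (s + T) y - fderiv ℝ (U₀ (s + T)) y)) =
      ENNReal.ofReal (frobeniusNormSq (G' s y - fderiv ℝ (U₀ s) y))
    rw [hG'T, e]
  have hfin' : ∫⁻ z in Ioo 0 T ×ˢ (univ : Set (EuclideanSpace ℝ (Fin 3))),
      ENNReal.ofReal (frobeniusNormSq (G' z.1 z.2 - fderiv ℝ (U₀ z.1) z.2)) < ∞ := by
    rw [setLIntegral_congr_fun_ae (measurableSet_Ioo.prod MeasurableSet.univ)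
      (hae.mono fun z hz _ => by rw [hz])]
    exact hfin
  exact setLIntegral_Ioo_prod_lt_top_of_periodic hFm hT hper hfin' a b

/-- **`|G'|²` is integrable on compact sets** once `∫∫_{(a,b)×ℝ³} |G' − DU₀|² < ∞` on every bounded
window and `U₀` is `C¹` (`|G'|² ≤ 2|G' − DU₀|² + 2|DU₀|²`, the first term integrable on the bounded
window containing the compact set, the second bounded on it). [folklore] -/
theorem setLIntegral_isCompact_lt_top_of_window {G' : ℝ → (EuclideanSpace ℝ (Fin 3)) → (EuclideanSpace ℝ (Fin 3)) →L[ℝ] (EuclideanSpace ℝ (Fin 3))}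
    (hU₀ : ContDiff ℝ 1 (uncurry U₀))
    (hwin : ∀ a b : ℝ, ∫⁻ z in Ioo a b ×ˢ (univ : Set (EuclideanSpace ℝ (Fin 3))),
      ENNReal.ofReal (frobeniusNormSq (G' z.1 z.2 - fderiv ℝ (U₀ z.1) z.2)) < ∞)
    {K : Set (ℝ × (EuclideanSpace ℝ (Fin 3)))} (hK : IsCompact K) :
    ∫⁻ z in K, ENNReal.ofReal (frobeniusNormSq (G' z.1 z.2)) < ∞ := by
  obtain ⟨a, b, hKab⟩ := exists_Ioo_prod_of_isCompact hK
  -- the continuous term `|DU₀|²` is bounded on `K`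
  have hcont : Continuous fun z : ℝ × (EuclideanSpace ℝ (Fin 3)) => frobeniusNormSq (fderiv ℝ (U₀ z.1) z.2) :=
    LerayHopfProofs.continuous_frobeniusNormSq.comp (continuous_fderiv_slice_of_contDiff hU₀)
  obtain ⟨M, hM⟩ := hK.exists_bound_of_continuousOn hcont.continuousOn
  have hbound : ∀ z ∈ K, ENNReal.ofReal (frobeniusNormSq (G' z.1 z.2)) ≤
      2 * ENNReal.ofReal (frobeniusNormSq (G' z.1 z.2 - fderiv ℝ (U₀ z.1) z.2)) +
        ENNReal.ofReal (2 * M) := by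
    intro z hz
    have h1 := frobeniusNormSq_add_le (G' z.1 z.2 - fderiv ℝ (U₀ z.1) z.2) (fderiv ℝ (U₀ z.1) z.2)
    rw [sub_add_cancel] at h1
    have h2 : frobeniusNormSq (fderiv ℝ (U₀ z.1) z.2) ≤ M := by
      have := hM z hz
      rw [Real.norm_eq_abs, abs_of_nonneg (frobeniusNormSq_nonneg _)] at this
      exact this
    calc ENNReal.ofReal (frobeniusNormSq (G' z.1 z.2))
        ≤ ENNReal.ofReal (2 * frobeniusNormSq (G' z.1 z.2 - fderiv ℝ (U₀ z.1) z.2) + 2 * M) :=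
          ENNReal.ofReal_le_ofReal (by linarith)
      _ = 2 * ENNReal.ofReal (frobeniusNormSq (G' z.1 z.2 - fderiv ℝ (U₀ z.1) z.2)) +
            ENNReal.ofReal (2 * M) := by
          rw [ENNReal.ofReal_add (mul_nonneg zero_le_two (frobeniusNormSq_nonneg _))
              (mul_nonneg zero_le_two ((frobeniusNormSq_nonneg _).trans h2)),
            ENNReal.ofReal_mul zero_le_two, ENNReal.ofReal_ofNat]
  calc ∫⁻ z in K, ENNReal.ofReal (frobeniusNormSq (G' z.1 z.2))
      ≤ ∫⁻ z in K, (2 * ENNReal.ofReal (frobeniusNormSq (G' z.1 z.2 - fderiv ℝ (U₀ z.1) z.2)) +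
          ENNReal.ofReal (2 * M)) := setLIntegral_mono' hK.measurableSet hbound
    _ ≤ (∫⁻ z in K, 2 * ENNReal.ofReal (frobeniusNormSq (G' z.1 z.2 - fderiv ℝ (U₀ z.1) z.2))) +
          ∫⁻ z in K, ENNReal.ofReal (2 * M) := le_of_eq (lintegral_add_right _ measurable_const)
    _ < ∞ := by
        refine ENNReal.add_lt_top.2 ⟨?_, ?_⟩
        · rw [lintegral_const_mul' _ _ (by simp)]
          refine ENNReal.mul_lt_top (by simp) ?_
          exact lt_of_le_of_lt (lintegral_mono_set hKab) (hwin a b)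
        · rw [setLIntegral_const]
          exact ENNReal.mul_lt_top ENNReal.ofReal_lt_top hK.measure_lt_top

/-- **A periodic field has a periodic weak spatial gradient of finite dissipation on every
window.** Let `u` be `T`-periodic (`T > 0`) with a weak spatial gradient `G` on `ℝ × ℝ³`, `U₀` a
`T`-periodic jointly `C¹` profile, and `∫∫_{(0,T)×ℝ³} |G − DU₀|² < ∞` ([BT1] Def. 2.2:
`u − U₀ ∈ L²(0,T;H¹(ℝ³))`, with one weak gradient `∇u` on `ℝ × ℝ³`). Then there is a weak spatial
gradient `G̃` of `u` on `ℝ × ℝ³` which is `T`-periodic in time, agrees with `G` a.e., and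
satisfies `∫∫_{(a,b)×ℝ³} |G̃ − DU₀|² < ∞` for all `a, b` and `∫∫_K |G̃|² < ∞` for every compact
`K` (namely the periodisation `G̃(s,y) = G(T·fract(s/T), y)`; weak gradients are unique a.e., so
`G` is a.e. periodic). This is the form in which the class `u − U₀ ∈ L²(0,T;H¹)` is consumed by
the change of variables of [BT1] §4, whose physical window `1 ≤ t ≤ λ²` is the similarity
window `(σ(1), σ(1) + T)`. [cite: BradshawTsai2017AHP, Def. 2.2 and §4 (proof of Thm 1.2)] -/
theorem exists_periodic_weakGradient
    (hG : HasWeakSpatialGradientOn (⊤ : Opens (ℝ × (EuclideanSpace ℝ (Fin 3)))) u G) (hT : 0 < T)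
    (hu : ∀ s y, u (s + T) y = u s y) (hU₀ : ContDiff ℝ 1 (uncurry U₀))
    (hU₀T : ∀ s y, U₀ (s + T) y = U₀ s y)
    (hfin : ∫⁻ z in Ioo 0 T ×ˢ (univ : Set (EuclideanSpace ℝ (Fin 3))),
      ENNReal.ofReal (frobeniusNormSq (G z.1 z.2 - fderiv ℝ (U₀ z.1) z.2)) < ∞) :
    ∃ G' : ℝ → (EuclideanSpace ℝ (Fin 3)) → (EuclideanSpace ℝ (Fin 3)) →L[ℝ] (EuclideanSpace ℝ (Fin 3)),
      HasWeakSpatialGradientOn (⊤ : Opens (ℝ × (EuclideanSpace ℝ (Fin 3)))) u G' ∧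
      (∀ s y, G' (s + T) y = G' s y) ∧
      (∀ᵐ z : ℝ × (EuclideanSpace ℝ (Fin 3)), G' z.1 z.2 = G z.1 z.2) ∧
      (∀ a b : ℝ, ∫⁻ z in Ioo a b ×ˢ (univ : Set (EuclideanSpace ℝ (Fin 3))),
        ENNReal.ofReal (frobeniusNormSq (G' z.1 z.2 - fderiv ℝ (U₀ z.1) z.2)) < ∞) ∧
      (∀ K : Set (ℝ × (EuclideanSpace ℝ (Fin 3))), IsCompact K →
        ∫⁻ z in K, ENNReal.ofReal (frobeniusNormSq (G' z.1 z.2)) < ∞) :=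
  by
  have hG' := hG.periodize hT.ne' hu
  have hG'T : ∀ s y, (fun s y => G (Int.fract (s / T) * T) y) (s + T) y =
      (fun s y => G (Int.fract (s / T) * T) y) s y := fun s y => periodize_add hT.ne' G s y
  have hae := hG.periodize_ae_eq hT.ne' hu
  have hwin := setLIntegral_window_sub_lt_top_of_periodic hG' hT hG'T hae hU₀ hU₀T hfin
  refine ⟨_, hG', hG'T, hae, hwin, fun K hK => ?_⟩
  exact setLIntegral_isCompact_lt_top_of_window
    (G' := fun s y => G (Int.fract (s / T) * T) y) hU₀ hwin hK

end BradshawTsai2017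

end Literature.Analysis.FluidPDE

end
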